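import Summits.ResolutionOfSingularities.ResolutionOfSingularities.Theorems.HomologicalConductorSurfaceTerminationChartResolution
import HarnessLib

/-!
# Route `HomologicalConductor`, support `SurfaceTermination` (stmt-ResolutionOfSingularities-16488):
# the chart triangle `σ ≫ Spec ψ = τ` and `V.ι ≫ σ_B = σ ≫ Spec ψ ≫ chartι`

`[OURS · L W4.4]` Cell res-hironaka, crux chain W4.4, kill test K4.4-s; U2e brick of res-L0-w44-stub-4 over
res-L0-w44-stub-1's chart dictionary (`…SurfaceTerminationChartResolution`, p528448).  Nothing here is a
statement of the manuscript under review (Hironaka 2017); AI-written, weaker than expert review.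

With stub-1's binders (`σB : Z ⟶ Bl_I`, chart `x ∈ I`, `V = σ_B⁻¹(D₊(xt))`, the chart morphism
`τ : V ⟶ Spec (T[It])_{(xt)}` with `τ ≫ chartι = V.ι ≫ σ_B`, a ring map `ψ : (T[It])_{(xt)} → N` taking a
chart function to its VALUE, and `σ : V ⟶ Spec N` giving `y ∈ N` the section of value `y`):

* `comp_specMap_eq_chartHom` — **`σ ≫ Spec ψ = τ`** (rigidity `hom_ext_of_sectionVal`: both give every chart
  function the section with its value; this is the internal step `hσψ` of stub-1's `exists_chartMorphism`,
  exported);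
* `ι_comp_eq_comp_specMap_chartι` — hence **`V.ι ≫ σ_B = σ ≫ Spec ψ ≫ chartι`**: the (S)-step of
  `stub_pgNonincreasing` rewrites `σ_B`-preimages of opens of the blowing up inside `V` as `σ`-preimages of
  opens of `Spec N` (`preimage_ι_eq_preimage_comp`).

No named facts; no definitions.
-/

noncomputable section
set_option linter.dupNamespace false

namespace Summit.ResolutionOfSingularities.ResolutionOfSingularities.Theorems.SurfaceTermination.ChartResolution

open CategoryTheory AlgebraicGeometry TopologicalSpace Opposite
open Literature.AlgebraicGeometry.Resolution Literature.AlgebraicGeometry.Motives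

variable {k K : Type} [Field k] [Field K] [Algebra k K]
variable {Z : Scheme.{0}} [IsIntegral Z] (e : ↑Z.functionField ≃+* K)
  {T : Type} [CommRing T] {I : Ideal T} (σB : Z ⟶ affineBlowup I) {x : T} (hxI : x ∈ I)
  (τ : ((σB ⁻¹ᵁ (affineBlowup.chartOpen x hxI).1 : Z.Opens) : Scheme.{0}) ⟶
    Spec (.of (HomogeneousLocalization.Away (reesGrading I) (reesT x hxI))))
  (hτ : τ ≫ affineBlowup.chartι x hxI = (σB ⁻¹ᵁ (affineBlowup.chartOpen x hxI).1).ι ≫ σB)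
  (hη : genericPoint Z ∈ (σB ⁻¹ᵁ (affineBlowup.chartOpen x hxI).1).ι ''ᵁ ⊤)
  (N : Subalgebra k K)
  (ψ : CommRingCat.of (HomogeneousLocalization.Away (reesGrading I) (reesT x hxI)) ⟶ CommRingCat.of ↥N)
  (hψ : ∀ a, ((ψ.hom a : ↥N) : K) = e (Z.presheaf.germ _ (genericPoint Z) hη
    (τ.appTop ((Scheme.ΓSpecIso (.of (HomogeneousLocalization.Away (reesGrading I) (reesT x hxI)))).inv a))))
  (σ : ((σB ⁻¹ᵁ (affineBlowup.chartOpen x hxI).1 : Z.Opens) : Scheme.{0}) ⟶ Spec (.of ↥N))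
  (hσ : ∀ y : ↥N, e (Z.presheaf.germ _ (genericPoint Z) hη
    (σ.appTop ((Scheme.ΓSpecIso (.of ↥N)).inv y))) = (y : K))

include hψ hσ in
/-- **The chart triangle `σ ≫ Spec ψ = τ`** (rigidity: every chart function `a` gets, under both morphisms,
the section of `V` whose value is the value of `a`). [this work] -/
theorem comp_specMap_eq_chartHom : σ ≫ Spec.map ψ = τ := by
  refine hom_ext_of_sectionVal e (σB ⁻¹ᵁ (affineBlowup.chartOpen x hxI).1) hη _ _ fun a => ?_
  have hnat := congrArg (fun φ => φ.hom a) (Scheme.ΓSpecIso_inv_naturality ψ)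
  simp only [CommRingCat.hom_comp, RingHom.coe_comp, Function.comp_apply] at hnat
  rw [Scheme.Hom.comp_appTop, CommRingCat.comp_apply]
  erw [← hnat]
  rw [hσ (ψ.hom a)]
  exact hψ a

include hτ hψ hσ in
/-- **`V.ι ≫ σ_B = σ ≫ Spec ψ ≫ chartι`**: the restriction of `σ_B` to the chart preimage factors through the
chart morphism `σ` to the normalised chart. [this work] -/
theorem ι_comp_eq_comp_specMap_chartι :
    (σB ⁻¹ᵁ (affineBlowup.chartOpen x hxI).1).ι ≫ σB =
      σ ≫ Spec.map ψ ≫ affineBlowup.chartι x hxI := by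
  rw [← hτ, ← comp_specMap_eq_chartHom e σB hxI τ hη N ψ hψ σ hσ, Category.assoc]

include hτ hψ hσ in
/-- Consequently, for every open `Ω` of the blowing up, the preimage of `σ_B⁻¹Ω` in `V` is the `σ`-preimage of
the open `(Spec ψ ≫ chartι)⁻¹Ω` of `Spec N`. [this work] -/
theorem preimage_ι_eq_preimage_comp (Ω : (affineBlowup I).Opens) :
    (σB ⁻¹ᵁ (affineBlowup.chartOpen x hxI).1).ι ⁻¹ᵁ (σB ⁻¹ᵁ Ω) =
      σ ⁻¹ᵁ ((Spec.map ψ ≫ affineBlowup.chartι x hxI) ⁻¹ᵁ Ω) := by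
  rw [← Scheme.Hom.comp_preimage, ← Scheme.Hom.comp_preimage,
    ι_comp_eq_comp_specMap_chartι e σB hxI τ hτ hη N ψ hψ σ hσ]

end Summit.ResolutionOfSingularities.ResolutionOfSingularities.Theorems.SurfaceTermination.ChartResolution

end
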